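import Literature.NumberTheory.Transcendental.PhilipponZeroEstimateStd
import Mathlib.Topology.Algebra.MvPolynomial
import Mathlib.Topology.Algebra.Module.Cardinality
import Mathlib.Algebra.Algebra.Operations
import Mathlib.Algebra.Group.Pointwise.Set.BigOperators
import HarnessLib

/-!
# The Hilbert function of the theta model of `M_κ`: the upper bound `H(M_κ; D) ≤ 6ⁿ Dⁿ`

Topic: `Literature/NumberTheory/Transcendental`. A first brick towards the discharge of the named
fact `PhilipponZeroEstimateStd.philippon1986_std` (Philippon 1986, Thm. 2.1, for the group
varieties `M_κ = 𝔾ₘ^β × P_κ` in the theta embedding of `PkappaTheta.lean`), following D. Roy's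
proof (Nesterenko–Philippon (eds.), LNM 1752, Ch. 11): the right-hand side of the zero estimate is
`ℋ(G; cD) = deg(G)·(cD)ⁿ` (op. cit. §2.2 (i)–(ii), Thm. 4.1), i.e. one needs that the Hilbert
function `H(𝔊; D) = dim_ℂ ℂ[X]_D/𝔊_D` of the ideal `𝔊 = 𝔍(M_κ)` of the embedded group is
`O(Dⁿ)`, `n = dim M_κ = |β| + |γ| + |δ|`. In the theta model `ℂ[X]_D/𝔊_D` is the space
`GaGmE.Std.thetaSpace L κM D` of the entire functions `F_P = P(Θ)` (`GaGmE.Std.thetaEval`), `P` a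
form of degree `D`, and we PROVE the elementary bound

* `GaGmE.Std.finrank_thetaSpace_le` — `dim_ℂ thetaSpace D ≤ 6ⁿ·Dⁿ` for `D ≥ 1`

(and its linear-independence form `GaGmE.Std.card_le_of_linearIndependent_thetaEval`).

Proof: off the divisors `z'_b ∈ Λ` (the dense set `GaGmE.Std.offDiv`, where the `F_P`, being
continuous, are determined) every theta function is `∏_b σ(z'_b)³` times a polynomial in
`e^{y'_j}` (degree `≤ 1` in each), `ν_e = s_e - ∑_b κ_{eb} ζ(z'_b)` (degree `≤ 1`) and
`℘(z'_b), ℘′(z'_b)` (weighted degree `≤ 4` in each block, `wt ℘ = 2`, `wt ℘′ = 3`)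
(`thetaPnone_eq`, `thetaPsome_eq`); hence a theta monomial of degree `D` is `∏_b σ_b^{3D}` times a
polynomial of partial degrees `≤ D` in the `e^{y'_j}` and the `ν_e` and of weighted degree `≤ 4D`
in each block `(℘_b, ℘′_b)`; reducing `℘′² = 4℘³ - g₂℘ - g₃` (Mathlib
`PeriodPair.derivWeierstrassP_sq`) such a polynomial is a combination of the
`(D+1)^{|β|}·(D+1)^{|δ|}·(2(2D+1))^{|γ|} ≤ 6ⁿDⁿ` monomials `e^{m·y'} ν^α ∏_b ℘_b^{a_b} ℘′_b^{c_b}`,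
`m_j ≤ D`, `α_e ≤ D`, `a_b ≤ 2D`, `c_b ≤ 1`. Only bookkeeping definitions (sets of monomials in
the algebra `GaGmE.Std.Fn` of functions off the divisors); no named facts.

## References

* Yu. V. Nesterenko, P. Philippon (eds.), *Introduction to Algebraic Independence Theory*,
  LNM 1752, Springer 2001, Ch. 11 (D. Roy), §2.2 (Hilbert function, `ℋ(G; D) = deg(G) Dⁿ`),
  Thm. 4.1.
* P. Philippon, *Lemmes de zéros dans les groupes algébriques commutatifs*, Bull. Soc. Math.
  France 114 (1986), 355–383, §3 (fonctions de Hilbert–Samuel), Thm. 2.1 (`H(G; c₁D₁, …)`).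
-/

noncomputable section

open Complex MvPolynomial Module
open scoped PeriodPair Pointwise

namespace Literature.NumberTheory.Transcendental

namespace GaGmE

namespace Std

variable {β γ δ : Type} [Fintype β] [Fintype γ] [Fintype δ] [DecidableEq γ]
variable (L : PeriodPair) (κM : δ → γ → Kbar)

/-! ### The space of theta polynomials of degree `D` -/

/-- `P ↦ F_P = P(Θ)` as a `ℂ`-linear map into the functions on `Lie M_κ,ℂ`. [folklore] -/
def thetaEvalₗ : MvPolynomial (Option β × ThetaIdx γ δ) ℂ →ₗ[ℂ] ((β ⊕ (γ ⊕ δ) → ℂ) → ℂ) where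
  toFun P := thetaEval L κM P
  map_add' P Q := by funext w; simp [thetaEval]
  map_smul' c P := by funext w; simp [thetaEval, smul_eval]

omit [Fintype β] [Fintype δ] in
/-- `thetaEvalₗ P = F_P`. [folklore] -/
@[simp] theorem thetaEvalₗ_apply (P : MvPolynomial (Option β × ThetaIdx γ δ) ℂ) :
    thetaEvalₗ L κM P = thetaEval L κM P := rfl

/-- **The space `S_D = ℂ[X]_D / 𝔊_D` of theta polynomials of degree `D`**: the functions
`F_P = P(Θ)` on `Lie M_κ,ℂ`, `P` a form of degree `D`; its dimension is the value `H(𝔊; D)` of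
the Hilbert function of the ideal `𝔊 = 𝔍(M_κ)` of the theta-embedded group.
[cite: NesterenkoPhilippon2001, Ch. 11 §2.2 (Hilbert function H(I; D))] -/
def thetaSpace (D : ℕ) : Submodule ℂ ((β ⊕ (γ ⊕ δ) → ℂ) → ℂ) :=
  (homogeneousSubmodule (Option β × ThetaIdx γ δ) ℂ D).map (thetaEvalₗ L κM)

/-- `F_P` is continuous (indeed entire). [folklore] -/
theorem continuous_thetaEval (P : MvPolynomial (Option β × ThetaIdx γ δ) ℂ) :
    Continuous (thetaEval L κM P) := by
  have h1 : Continuous fun w : β ⊕ (γ ⊕ δ) → ℂ => fun J : Option β × ThetaIdx γ δ => theta L κM J w :=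
    continuous_pi fun J => (differentiable_theta L κM J).continuous
  exact (MvPolynomial.continuous_eval P).comp h1

/-! ### Off the divisors -/

/-- The set of `w ∈ Lie M_κ,ℂ` off the divisors `z'_b ∈ Λ`. [folklore] -/
def offDiv (L : PeriodPair) (β γ δ : Type) : Set (β ⊕ (γ ⊕ δ) → ℂ) :=
  {w | ∀ b : γ, w (iz b) ∉ L.lattice}

omit [Fintype β] [Fintype γ] [Fintype δ] [DecidableEq γ] in
/-- Membership in `offDiv`. [folklore] -/
theorem mem_offDiv {w : β ⊕ (γ ⊕ δ) → ℂ} : w ∈ offDiv L β γ δ ↔ ∀ b : γ, w (iz b) ∉ L.lattice :=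
  Iff.rfl

/-- The lattice is countable. [folklore] -/
theorem countable_lattice : (L.lattice : Set ℂ).Countable := by
  have : (L.lattice : Set ℂ) ⊆ Set.range (fun p : ℤ × ℤ => (p.1 : ℂ) * L.ω₁ + (p.2 : ℂ) * L.ω₂) := by
    intro x hx
    obtain ⟨m, n, h⟩ := PeriodPair.mem_lattice.mp hx
    exact ⟨(m, n), h⟩
  exact (Set.countable_range _).mono this

omit [Fintype β] [Fintype γ] [Fintype δ] [DecidableEq γ] in
/-- `offDiv` is dense in `Lie M_κ,ℂ`. [folklore] -/
theorem dense_offDiv : Dense (offDiv L β γ δ) := by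
  have hΛ : Dense ((L.lattice : Set ℂ)ᶜ) := (countable_lattice L).dense_compl ℂ
  have heq : offDiv L β γ δ = Set.pi Set.univ (fun i : β ⊕ (γ ⊕ δ) =>
      Sum.elim (fun _ => (Set.univ : Set ℂ)) (Sum.elim (fun _ => ((L.lattice : Set ℂ))ᶜ) fun _ => Set.univ) i) := by
    ext w
    simp only [offDiv, Set.mem_setOf_eq, Set.mem_pi, Set.mem_univ, true_implies, Sum.forall,
      Sum.elim_inl, Sum.elim_inr, Set.mem_compl_iff, SetLike.mem_coe]
    exact ⟨fun h => ⟨fun _ => trivial, h, fun _ => trivial⟩, fun h => h.2.1⟩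
  rw [heq]
  refine dense_pi Set.univ fun i _ => ?_
  rcases i with _ | _ | _
  · exact dense_univ
  · exact hΛ
  · exact dense_univ

/-- **The algebra of functions off the divisors.** [folklore] -/
abbrev Fn (L : PeriodPair) (β γ δ : Type) : Type := ↥(offDiv L β γ δ) → ℂ

/-- Restriction of functions on `Lie M_κ,ℂ` to `offDiv`. [folklore] -/
def res : ((β ⊕ (γ ⊕ δ) → ℂ) → ℂ) →ₗ[ℂ] Fn L β γ δ :=
  LinearMap.funLeft ℂ ℂ (Subtype.val : ↥(offDiv L β γ δ) → (β ⊕ (γ ⊕ δ) → ℂ))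

omit [Fintype β] [Fintype γ] [Fintype δ] [DecidableEq γ] in
/-- `res f w = f w`. [folklore] -/
@[simp] theorem res_apply (f : (β ⊕ (γ ⊕ δ) → ℂ) → ℂ) (w : ↥(offDiv L β γ δ)) : res L f w = f w.1 := rfl

/-- A theta polynomial vanishing off the divisors vanishes (continuity and density). [folklore] -/
theorem eq_zero_of_res_eq_zero {f : (β ⊕ (γ ⊕ δ) → ℂ) → ℂ} {D : ℕ}
    (hf : f ∈ thetaSpace (β := β) L κM D) (h : res L f = 0) : f = 0 := by
  obtain ⟨P, -, rfl⟩ := Submodule.mem_map.mp hf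
  have hc : Continuous (thetaEvalₗ L κM P) := continuous_thetaEval L κM P
  refine Continuous.ext_on (dense_offDiv (β := β) (γ := γ) (δ := δ) L) hc continuous_const ?_
  intro w hw
  have := congr_fun h ⟨w, hw⟩
  simpa using this

/-! ### The monomials of the algebra of functions off the divisors -/

/-- `e^{y'_j}` off the divisors. [folklore] -/
def fT (j : β) : Fn L β γ δ := fun w => cexp (w.1 (iy j))
/-- `℘(z'_b)` off the divisors. [folklore] -/
def fX (b : γ) : Fn L β γ δ := fun w => ℘[L] (w.1 (iz b))
/-- `℘′(z'_b)` off the divisors. [folklore] -/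
def fY (b : γ) : Fn L β γ δ := fun w => ℘'[L] (w.1 (iz b))
/-- `ν_e = s_e - ∑_b κ_{eb} ζ(z'_b)` off the divisors. [folklore] -/
def fN (e : δ) : Fn L β γ δ :=
  fun w => w.1 (is e) - ∑ b, (κM e b : ℂ) * L.weierstrassZeta (w.1 (iz b))
/-- `∏_b σ(z'_b)³` off the divisors. [folklore] -/
def fS : Fn L β γ δ := fun w => ∏ b : γ, L.weierstrassSigma (w.1 (iz b)) ^ 3

/-- Torus monomials `e^{m·y'}`, `m_j ≤ k`. [folklore] -/
def setT (k : ℕ) : Set (Fn L β γ δ) :=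
  (fun m : β → ℕ => ∏ j, fT L j ^ m j) '' {m | ∀ j, m j ≤ k}

/-- Fibre monomials `ν^α`, `α_e ≤ k`. [folklore] -/
def setN (k : ℕ) : Set (Fn L β γ δ) :=
  (fun α : δ → ℕ => ∏ e, fN L κM e ^ α e) '' {α | ∀ e, α e ≤ k}

/-- Block monomials `℘_b^a ℘′_b^c` of weighted degree `2a + 3c ≤ k`. [folklore] -/
def setE (b : γ) (k : ℕ) : Set (Fn L β γ δ) :=
  (fun p : ℕ × ℕ => fX L b ^ p.1 * fY L b ^ p.2) '' {p | 2 * p.1 + 3 * p.2 ≤ k}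

/-- Reduced block monomials `℘_b^a ℘′_b^c`, `2a ≤ k`, `c ≤ 1`. [folklore] -/
def setEred (b : γ) (k : ℕ) : Set (Fn L β γ δ) :=
  (fun p : ℕ × ℕ => fX L b ^ p.1 * fY L b ^ p.2) '' {p | 2 * p.1 ≤ k ∧ p.2 ≤ 1}

/-- Products `e^{m·y'} ν^α ∏_b ℘_b^{a_b} ℘′_b^{c_b}` with `m_j ≤ k₁`, `α_e ≤ k₂`,
`2a_b + 3c_b ≤ k₃`. [folklore] -/
def setS (k₁ k₂ k₃ : ℕ) : Set (Fn L β γ δ) :=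
  setT L k₁ * setN L κM k₂ * ∏ b : γ, setE L b k₃

/-- The reduced products (`2a_b ≤ k₃`, `c_b ≤ 1`). [folklore] -/
def setSred (k₁ k₂ k₃ : ℕ) : Set (Fn L β γ δ) :=
  setT L k₁ * setN L κM k₂ * ∏ b : γ, setEred L b k₃

omit [Fintype γ] [Fintype δ] [DecidableEq γ] in
/-- `setT` is multiplicative. [folklore] -/
theorem setT_mul_subset (k l : ℕ) : setT L k * setT L l ⊆ (setT L (k + l) : Set (Fn L β γ δ)) := by
  rintro _ ⟨_, ⟨m, hm, rfl⟩, _, ⟨m', hm', rfl⟩, rfl⟩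
  refine ⟨m + m', fun j => Nat.add_le_add (hm j) (hm' j), ?_⟩
  simp only [Pi.add_apply, pow_add, Finset.prod_mul_distrib]

omit [Fintype β] [DecidableEq γ] in
/-- `setN` is multiplicative. [folklore] -/
theorem setN_mul_subset (k l : ℕ) :
    setN L κM k * setN L κM l ⊆ (setN L κM (k + l) : Set (Fn L β γ δ)) := by
  rintro _ ⟨_, ⟨m, hm, rfl⟩, _, ⟨m', hm', rfl⟩, rfl⟩
  refine ⟨m + m', fun e => Nat.add_le_add (hm e) (hm' e), ?_⟩
  simp only [Pi.add_apply, pow_add, Finset.prod_mul_distrib]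

omit [Fintype β] [Fintype γ] [Fintype δ] [DecidableEq γ] in
/-- `setE` is multiplicative. [folklore] -/
theorem setE_mul_subset (b : γ) (k l : ℕ) :
    setE L b k * setE L b l ⊆ (setE L b (k + l) : Set (Fn L β γ δ)) := by
  rintro _ ⟨_, ⟨p, hp, rfl⟩, _, ⟨q, hq, rfl⟩, rfl⟩
  refine ⟨(p.1 + q.1, p.2 + q.2), ?_, ?_⟩
  · simp only [Set.mem_setOf_eq] at hp hq ⊢
    omega
  · simp only [pow_add]
    ring

omit [DecidableEq γ] in
/-- `setS` is multiplicative. [folklore] -/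
theorem setS_mul_subset (k₁ k₂ k₃ l₁ l₂ l₃ : ℕ) :
    setS L κM k₁ k₂ k₃ * setS L κM l₁ l₂ l₃ ⊆
      (setS L κM (k₁ + l₁) (k₂ + l₂) (k₃ + l₃) : Set (Fn L β γ δ)) := by
  have heq : (setS L κM k₁ k₂ k₃ * setS L κM l₁ l₂ l₃ : Set (Fn L β γ δ)) =
      (setT L k₁ * setT L l₁) * (setN L κM k₂ * setN L κM l₂) *
        ∏ b : γ, (setE L b k₃ * setE L b l₃) := by
    simp only [setS, Finset.prod_mul_distrib]
    rw [mul_mul_mul_comm, mul_mul_mul_comm (setT L k₁)]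
  rw [heq]
  exact Set.mul_subset_mul (Set.mul_subset_mul (setT_mul_subset L k₁ l₁) (setN_mul_subset L κM k₂ l₂))
    (Set.finsetProd_subset_finsetProd _ _ _ fun b _ => setE_mul_subset L b k₃ l₃)

omit [DecidableEq γ] in
/-- `1 ∈ setS 0 0 0`. [folklore] -/
theorem one_mem_setS : (1 : Fn L β γ δ) ∈ setS L κM 0 0 0 := by
  have hT : (1 : Fn L β γ δ) ∈ setT L 0 := ⟨0, fun _ => le_rfl, by simp⟩
  have hN : (1 : Fn L β γ δ) ∈ setN L κM 0 := ⟨0, fun _ => le_rfl, by simp⟩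
  have hE : ∀ b, (1 : Fn L β γ δ) ∈ setE L b 0 := fun b => ⟨(0, 0), by simp, by simp⟩
  have hP : (1 : Fn L β γ δ) ∈ ∏ b : γ, setE L b 0 := by
    have := Set.finsetProd_mem_finsetProd Finset.univ (fun b => (setE L b 0 : Set (Fn L β γ δ)))
      (fun _ => 1) fun b _ => hE b
    simpa using this
  simpa [setS] using Set.mul_mem_mul (Set.mul_mem_mul hT hN) hP

omit [DecidableEq γ] in
/-- Powers: `setS 1 1 4 ^ D ⊆ setS D D (4D)`. [folklore] -/
theorem setS_pow_subset (D : ℕ) :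
    setS L κM 1 1 4 ^ D ⊆ (setS L κM D D (4 * D) : Set (Fn L β γ δ)) := by
  induction D with
  | zero =>
    rw [pow_zero]
    exact Set.one_subset.mpr (one_mem_setS L κM)
  | succ D ih =>
    rw [pow_succ]
    refine (Set.mul_subset_mul ih Set.Subset.rfl).trans ?_
    have := setS_mul_subset (β := β) L κM D D (4 * D) 1 1 4
    rwa [show 4 * D + 4 = 4 * (D + 1) by ring] at this

omit [Fintype β] [Fintype γ] [Fintype δ] [DecidableEq γ] in
/-- **Reduction `℘′² → 4℘³ - g₂℘ - g₃`**: every block monomial of weighted degree `≤ k` is a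
combination of reduced ones. [folklore] -/
theorem setE_subset_span_setEred (b : γ) (k : ℕ) :
    setE L b k ⊆ ((Submodule.span ℂ (setEred L b k) : Submodule ℂ (Fn L β γ δ)) : Set (Fn L β γ δ)) := by
  rintro _ ⟨⟨a, c⟩, hac, rfl⟩
  simp only [Set.mem_setOf_eq] at hac
  change fX L b ^ a * fY L b ^ c ∈ (Submodule.span ℂ (setEred L b k) : Submodule ℂ (Fn L β γ δ))
  -- strong induction on `c`, for all `a`
  induction c using Nat.strong_induction_on generalizing a with
  | _ c ih =>
    rcases Nat.lt_or_ge c 2 with hc | hc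
    · exact Submodule.subset_span ⟨(a, c), ⟨by omega, by omega⟩, rfl⟩
    · obtain ⟨c', rfl⟩ : ∃ c', c = c' + 2 := ⟨c - 2, by omega⟩
      have hkey : (fX L b ^ a * fY L b ^ (c' + 2) : Fn L β γ δ) =
          (4 : ℂ) • (fX L b ^ (a + 3) * fY L b ^ c') - L.g₂ • (fX L b ^ (a + 1) * fY L b ^ c') -
            L.g₃ • (fX L b ^ a * fY L b ^ c') := by
        funext w
        simp only [Pi.mul_apply, Pi.sub_apply, Pi.smul_apply, Pi.pow_apply, smul_eq_mul, fY, fX]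
        have h := L.derivWeierstrassP_sq (w.1 (iz b)) (w.2 b)
        linear_combination (℘[L] (w.1 (iz b)) ^ a * ℘'[L] (w.1 (iz b)) ^ c') * h
      rw [hkey]
      refine Submodule.sub_mem _ (Submodule.sub_mem _ (Submodule.smul_mem _ _ ?_)
        (Submodule.smul_mem _ _ ?_)) (Submodule.smul_mem _ _ ?_)
      · exact ih c' (by omega) (a + 3) (by omega)
      · exact ih c' (by omega) (a + 1) (by omega)
      · exact ih c' (by omega) a (by omega)

/-- Products of submodules are monotone (finite products). [folklore] -/
theorem finsetProd_le_finsetProd {ι R A : Type*} [CommSemiring R] [CommSemiring A] [Algebra R A]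
    (s : Finset ι) {M N : ι → Submodule R A} (h : ∀ i ∈ s, M i ≤ N i) :
    ∏ i ∈ s, M i ≤ ∏ i ∈ s, N i := by
  classical
  induction s using Finset.induction_on with
  | empty => simp
  | @insert a s ha ih =>
    rw [Finset.prod_insert ha, Finset.prod_insert ha]
    exact mul_le_mul' (h a (Finset.mem_insert_self a s)) (ih fun i hi => h i (Finset.mem_insert_of_mem hi))

omit [DecidableEq γ] in
/-- `span (setS k₁ k₂ k₃) ≤ span (setSred k₁ k₂ k₃)`. [folklore] -/
theorem span_setS_le_span_setSred (k₁ k₂ k₃ : ℕ) :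
    (Submodule.span ℂ (setS L κM k₁ k₂ k₃) : Submodule ℂ (Fn L β γ δ)) ≤
      Submodule.span ℂ (setSred L κM k₁ k₂ k₃) := by
  simp only [setS, setSred, ← Submodule.span_mul_span, ← Submodule.prod_span]
  exact mul_le_mul' le_rfl (finsetProd_le_finsetProd _ fun b _ =>
    Submodule.span_le.mpr (setE_subset_span_setEred L b k₃))

/-- The index set of the reduced monomials of degree `D`. [folklore] -/
abbrev MonIdx (β γ δ : Type) (D : ℕ) : Type :=
  (β → Fin (D + 1)) × (δ → Fin (D + 1)) × (γ → Fin (2 * D + 1) × Fin 2)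

/-- The reduced monomials of degree `D`, as a finite family. [folklore] -/
def monFamily (D : ℕ) (i : MonIdx β γ δ D) : Fn L β γ δ :=
  (∏ j, fT L j ^ (i.1 j : ℕ)) * (∏ e, fN L κM e ^ (i.2.1 e : ℕ)) *
    ∏ b, fX L b ^ ((i.2.2 b).1 : ℕ) * fY L b ^ ((i.2.2 b).2 : ℕ)

omit [DecidableEq γ] in
/-- `setSred D D (4D)` consists of members of the finite family. [folklore] -/
theorem setSred_subset_range (D : ℕ) :
    (setSred L κM D D (4 * D) : Set (Fn L β γ δ)) ⊆ Set.range (monFamily L κM D) := by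
  rintro _ ⟨_, ⟨_, ⟨m, hm, rfl⟩, _, ⟨α, hα, rfl⟩, rfl⟩, f, hf, rfl⟩
  rw [Set.mem_finsetProd] at hf
  obtain ⟨g, hg, rfl⟩ := hf
  have hg' : ∀ b, ∃ p : ℕ × ℕ, (2 * p.1 ≤ 4 * D ∧ p.2 ≤ 1) ∧
      (fX L b ^ p.1 * fY L b ^ p.2 : Fn L β γ δ) = g b := fun b => by
    obtain ⟨p, hp, hpg⟩ := hg (Finset.mem_univ b)
    exact ⟨p, hp, hpg⟩
  choose p hp hpg using hg'
  simp only [Set.mem_setOf_eq] at hm hα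
  refine ⟨⟨fun j => ⟨m j, Nat.lt_succ_of_le (hm j)⟩, fun e => ⟨α e, Nat.lt_succ_of_le (hα e)⟩,
    fun b => (⟨(p b).1, by have := (hp b).1; omega⟩, ⟨(p b).2, by have := (hp b).2; omega⟩)⟩, ?_⟩
  simp only [monFamily]
  congr 1
  exact Finset.prod_congr rfl fun b _ => hpg b

omit [DecidableEq γ] in
/-- **The count**: `dim span (setS D D (4D)) ≤ (D+1)^{|β|} (D+1)^{|δ|} (2(2D+1))^{|γ|}`. [folklore] -/
theorem finrank_span_setS_le (D : ℕ) :
    finrank ℂ ↥(Submodule.span ℂ (setS L κM D D (4 * D)) : Submodule ℂ (Fn L β γ δ)) ≤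
      (D + 1) ^ Fintype.card β * ((D + 1) ^ Fintype.card δ * ((2 * D + 1) * 2) ^ Fintype.card γ) := by
  classical
  have h1 : (Submodule.span ℂ (setS L κM D D (4 * D)) : Submodule ℂ (Fn L β γ δ)) ≤
      Submodule.span ℂ (Set.range (monFamily L κM D)) :=
    (span_setS_le_span_setSred L κM D D (4 * D)).trans (Submodule.span_mono (setSred_subset_range L κM D))
  haveI : Module.Finite ℂ ↥(Submodule.span ℂ (Set.range (monFamily (β := β) L κM D))) :=
    Module.Finite.span_of_finite ℂ (Set.finite_range _)
  calc finrank ℂ ↥(Submodule.span ℂ (setS L κM D D (4 * D)) : Submodule ℂ (Fn L β γ δ))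
      ≤ finrank ℂ ↥(Submodule.span ℂ (Set.range (monFamily (β := β) L κM D))) := Submodule.finrank_mono h1
    _ ≤ Fintype.card (MonIdx β γ δ D) := finrank_range_le_card _
    _ = _ := by
      simp only [MonIdx, Fintype.card_prod, Fintype.card_fun, Fintype.card_fin]

/-! ### The theta functions off the divisors -/

/-- The blocks `A = (1, ℘, ℘′)` off the divisors. [folklore] -/
def fA (b : γ) (i : Fin 3) : Fn L β γ δ := ![1, fX L b, fY L b] i

/-- The corrections `B = (0, 0, 2℘²)` off the divisors. [folklore] -/
def fB (b : γ) (i : Fin 3) : Fn L β γ δ := ![0, 0, (2 : ℂ) • fX L b ^ 2] i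

/-- The torus coordinates off the divisors. [folklore] -/
def fT' : Option β → Fn L β γ δ
  | none => 1
  | some j => fT L j

/-- **The theta functions divided by `∏_b σ_b³`, as polynomials in the basic functions**:
`R_{(a,(M,none))} = T_a ∏_b A_{Mb}`,
`R_{(a,(M,some e))} = T_a (ν_e ∏_b A_{Mb} - ∑_b κ_{eb} B_{Mb} ∏_{b'≠b} A_{Mb'})`. [folklore] -/
def fR : Option β × ThetaIdx γ δ → Fn L β γ δ
  | (a, (M, none)) => fT' L a * ∏ b, fA L b (M b)
  | (a, (M, some e)) => fT' L a * (fN L κM e * ∏ b, fA L b (M b) -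
      ∑ b, (κM e b : ℂ) • (fB L b (M b) * ∏ b' ∈ Finset.univ.erase b, fA L b' (M b')))

omit [Fintype β] [Fintype δ] in
/-- `Θ_J = (∏_b σ_b³) · R_J` off the divisors. [folklore] -/
theorem theta_eq_fS_mul_fR (J : Option β × ThetaIdx γ δ) (w : ↥(offDiv L β γ δ)) :
    theta L κM J w.1 = fS L w * fR L κM J w := by
  have hw : ∀ b, w.1 (iz b) ∉ L.lattice := w.2
  have hA : ∀ b (i : Fin 3), ![1, ℘[L] (w.1 (iz b)), ℘'[L] (w.1 (iz b))] i = (fA L b i : Fn L β γ δ) w := by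
    intro b i
    fin_cases i <;> simp [fA, fX, fY]
  have hT : ∀ a, thetaT (γ := γ) (δ := δ) a w.1 = (fT' L a : Fn L β γ δ) w := by
    rintro (_ | j)
    · simp [fT']
    · simp [fT', fT]
  obtain ⟨a, M, _ | e⟩ := J
  · -- `J = (a, (M, none))`
    simp only [theta, thetaP_none, fR, Pi.mul_apply, Finset.prod_apply]
    rw [thetaPnone_eq L M hw, hT a]
    simp only [fS, hA]
    ring
  · -- `J = (a, (M, some e))`
    simp only [theta, thetaP_some, fR, Pi.mul_apply, Pi.sub_apply, Finset.sum_apply, Pi.smul_apply,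
      Finset.prod_apply, smul_eq_mul]
    rw [thetaPsome_eq L κM M e hw, hT a]
    -- decompose `Z/σ³ = ζ A + B` blockwise
    have hZ : ∀ b, ![L.weierstrassZeta (w.1 (iz b)), ℘[L] (w.1 (iz b)) * L.weierstrassZeta (w.1 (iz b)),
        ℘'[L] (w.1 (iz b)) * L.weierstrassZeta (w.1 (iz b)) + 2 * ℘[L] (w.1 (iz b)) ^ 2] (M b) =
        L.weierstrassZeta (w.1 (iz b)) * (fA L b (M b) : Fn L β γ δ) w + (fB L b (M b) : Fn L β γ δ) w := by
      intro b
      generalize M b = i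
      fin_cases i <;> simp [fA, fB, fX, fY] <;> ring
    have hprodA : ∀ b, (fA L b (M b) : Fn L β γ δ) w * ∏ b' ∈ Finset.univ.erase b, (fA L b' (M b') : Fn L β γ δ) w =
        ∏ b', (fA L b' (M b') : Fn L β γ δ) w := fun b =>
      Finset.mul_prod_erase Finset.univ (fun b' => (fA L b' (M b') : Fn L β γ δ) w) (Finset.mem_univ b)
    simp only [hA, hZ]
    have hsum : ∑ b, (κM e b : ℂ) * ((L.weierstrassZeta (w.1 (iz b)) * (fA L b (M b) : Fn L β γ δ) w +
        (fB L b (M b) : Fn L β γ δ) w) * ∏ b' ∈ Finset.univ.erase b, (fA L b' (M b') : Fn L β γ δ) w) =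
        (∑ b, (κM e b : ℂ) * L.weierstrassZeta (w.1 (iz b))) * ∏ b', (fA L b' (M b') : Fn L β γ δ) w +
        ∑ b, (κM e b : ℂ) * ((fB L b (M b) : Fn L β γ δ) w *
          ∏ b' ∈ Finset.univ.erase b, (fA L b' (M b') : Fn L β γ δ) w) := by
      rw [Finset.sum_mul, ← Finset.sum_add_distrib]
      refine Finset.sum_congr rfl fun b _ => ?_
      rw [← hprodA b]
      ring
    rw [hsum]
    simp only [fS, fN]
    ring

omit [Fintype γ] [Fintype δ] [DecidableEq γ] in
/-- `T_a ∈ setT 1`. [folklore] -/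
theorem fT'_mem_setT (a : Option β) : (fT' L a : Fn L β γ δ) ∈ setT L 1 := by
  classical
  rcases a with _ | j
  · exact ⟨0, fun _ => zero_le_one, by simp [fT']⟩
  · refine ⟨fun j' => if j' = j then 1 else 0, fun j' => by dsimp only; split_ifs <;> omega, ?_⟩
    simp only [fT']
    rw [Finset.prod_eq_single j (fun j' _ hj' => by simp [hj']) (fun h => absurd (Finset.mem_univ j) h)]
    simp

omit [Fintype β] [DecidableEq γ] in
/-- `ν_e ∈ setN 1`. [folklore] -/
theorem fN_mem_setN [DecidableEq δ] (e : δ) : (fN L κM e : Fn L β γ δ) ∈ setN L κM 1 := by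
  refine ⟨fun e' => if e' = e then 1 else 0, fun e' => by dsimp only; split_ifs <;> omega, ?_⟩
  simp only
  rw [Finset.prod_eq_single e (fun e' _ he' => by simp [he']) (fun h => absurd (Finset.mem_univ e) h)]
  simp

omit [Fintype β] [DecidableEq γ] in
/-- `1 ∈ setN 1`. [folklore] -/
theorem one_mem_setN : (1 : Fn L β γ δ) ∈ setN L κM 1 :=
  ⟨0, fun _ => zero_le_one, by simp⟩

omit [Fintype β] [Fintype γ] [Fintype δ] [DecidableEq γ] in
/-- `A_i ∈ setE 4`. [folklore] -/
theorem fA_mem_setE (b : γ) (i : Fin 3) : (fA L b i : Fn L β γ δ) ∈ setE L b 4 := by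
  fin_cases i
  · exact ⟨(0, 0), by simp, by simp [fA]⟩
  · exact ⟨(1, 0), by simp, by simp [fA]⟩
  · exact ⟨(0, 1), by simp, by simp [fA]⟩

omit [Fintype β] [Fintype γ] [Fintype δ] [DecidableEq γ] in
/-- `℘² ∈ setE 4`. [folklore] -/
theorem fX_sq_mem_setE (b : γ) : (fX L b ^ 2 : Fn L β γ δ) ∈ setE L b 4 :=
  ⟨(2, 0), by simp, by simp⟩

/-- **`R_J ∈ span (setS 1 1 4)`.** [folklore] -/
theorem fR_mem_span (J : Option β × ThetaIdx γ δ) :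
    fR L κM J ∈ (Submodule.span ℂ (setS L κM 1 1 4) : Submodule ℂ (Fn L β γ δ)) := by
  classical
  have hA : ∀ M : γ → Fin 3, ∏ b, (fA L b (M b) : Fn L β γ δ) ∈ ∏ b : γ, setE L b 4 := fun M =>
    Set.finsetProd_mem_finsetProd Finset.univ _ _ fun b _ => fA_mem_setE L b (M b)
  have hgen : ∀ (a : Option β) {ν p : Fn L β γ δ}, ν ∈ setN L κM 1 → p ∈ ∏ b : γ, setE L b 4 →
      fT' L a * ν * p ∈ (setS L κM 1 1 4 : Set (Fn L β γ δ)) := fun a ν p hν hp => by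
    simpa [setS] using Set.mul_mem_mul (Set.mul_mem_mul (fT'_mem_setT L a) hν) hp
  obtain ⟨a, M, _ | e⟩ := J
  · have := hgen a (one_mem_setN L κM) (hA M)
    rw [mul_one] at this
    exact Submodule.subset_span this
  · simp only [fR]
    rw [mul_sub, Finset.mul_sum]
    refine Submodule.sub_mem _ ?_ (Submodule.sum_mem _ fun b _ => ?_)
    · rw [← mul_assoc]
      exact Submodule.subset_span (hgen a (fN_mem_setN L κM e) (hA M))
    · rw [mul_smul_comm]
      refine Submodule.smul_mem _ _ ?_
      -- the correction term: `B_i = c_i • ℘²` with `c = (0, 0, 2)`, and `T_a · ℘_b² ∏_{b'≠b} A ∈ setS 1 1 4`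
      have hc : ∀ i : Fin 3, (fB L b i : Fn L β γ δ) = ((![0, 0, 2] : Fin 3 → ℂ) i) • fX L b ^ 2 := by
        intro i
        fin_cases i <;> simp [fB]
      rw [hc, smul_mul_assoc, mul_smul_comm]
      refine Submodule.smul_mem _ _ (Submodule.subset_span ?_)
      have hP : (fX L b ^ 2 : Fn L β γ δ) * ∏ b' ∈ Finset.univ.erase b, fA L b' (M b') ∈
          ∏ b' : γ, (setE L b' 4 : Set (Fn L β γ δ)) := by
        rw [← Finset.mul_prod_erase Finset.univ (fun b' => (setE L b' 4 : Set (Fn L β γ δ))) (Finset.mem_univ b)]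
        exact Set.mul_mem_mul (fX_sq_mem_setE L b)
          (Set.finsetProd_mem_finsetProd _ _ _ fun b' _ => fA_mem_setE L b' (M b'))
      have := hgen a (one_mem_setN L κM) hP
      rwa [mul_one] at this

/-- Products of powers lie in the power of the submodule. [folklore] -/
theorem prod_pow_mem_pow {ι R A : Type*} [CommSemiring R] [CommSemiring A] [Algebra R A]
    {M : Submodule R A} (s : Finset ι) (f : ι → A) (n : ι → ℕ) (h : ∀ i ∈ s, f i ∈ M) :
    ∏ i ∈ s, f i ^ n i ∈ M ^ ∑ i ∈ s, n i := by
  classical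
  induction s using Finset.induction_on with
  | empty =>
    simp only [Finset.prod_empty, Finset.sum_empty, pow_zero]
    exact Submodule.one_le.mp le_rfl
  | @insert a s ha ih =>
    rw [Finset.prod_insert ha, Finset.sum_insert ha, pow_add]
    exact Submodule.mul_mem_mul (Submodule.pow_mem_pow M (h a (Finset.mem_insert_self a s)) _)
      (ih fun i hi => h i (Finset.mem_insert_of_mem hi))

/-- **The restriction of a theta polynomial of degree `D` lies in `fS^D · span (setS D D (4D))`.**
[folklore] -/
theorem res_mem_of_isHomogeneous {P : MvPolynomial (Option β × ThetaIdx γ δ) ℂ} {D : ℕ}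
    (hP : P.IsHomogeneous D) :
    res L (thetaEval L κM P) ∈ (Submodule.span ℂ (setS L κM D D (4 * D))).map
      (LinearMap.mulLeft ℂ (fS L ^ D : Fn L β γ δ)) := by
  classical
  -- the degree of the monomials of `P`
  have hdeg : ∀ d ∈ P.support, ∑ J ∈ d.support, d J = D := fun d hd => by
    have h := hP (mem_support_iff.mp hd)
    simpa [Finsupp.weight_apply, Finsupp.sum] using h
  -- expand `P` into monomials
  have hres : res L (thetaEval L κM P) =
      ∑ d ∈ P.support, coeff d P • ((fS L ^ D : Fn L β γ δ) * ∏ J ∈ d.support, fR L κM J ^ d J) := by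
    funext w
    conv_lhs => rw [res_apply, MvPolynomial.as_sum P]
    simp only [thetaEval, map_sum, eval_monomial, Finset.sum_apply, Pi.smul_apply, Pi.mul_apply,
      Finset.prod_apply, Pi.pow_apply, smul_eq_mul]
    refine Finset.sum_congr rfl fun d hd => ?_
    congr 1
    rw [Finsupp.prod, Finset.prod_congr rfl fun J _ => by rw [theta_eq_fS_mul_fR L κM J w],
      Finset.prod_congr rfl fun J _ => mul_pow _ _ _, Finset.prod_mul_distrib,
      Finset.prod_pow_eq_pow_sum, hdeg d hd]
  rw [hres]
  refine Submodule.sum_mem _ fun d hd => Submodule.smul_mem _ _ (Submodule.mem_map_of_mem ?_)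
  have hmem : ∏ J ∈ d.support, fR L κM J ^ d J ∈
      (Submodule.span ℂ (setS L κM 1 1 4) : Submodule ℂ (Fn L β γ δ)) ^ D := by
    rw [← hdeg d hd]
    exact prod_pow_mem_pow _ _ _ fun J _ => fR_mem_span L κM J
  rw [Submodule.span_pow] at hmem
  exact Submodule.span_mono (setS_pow_subset L κM D) hmem

/-! ### The bound -/

/-- The finite-dimensional space `fS^D · span (setS D D (4D))` receiving the restrictions of the
theta polynomials of degree `D`. [folklore] -/
def bigV (D : ℕ) : Submodule ℂ (Fn L β γ δ) :=
  (Submodule.span ℂ (setS L κM D D (4 * D))).map (LinearMap.mulLeft ℂ (fS L ^ D : Fn L β γ δ))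

omit [DecidableEq γ] in
/-- `span (setS D D (4D))` is finite-dimensional. [folklore] -/
theorem finite_span_setS (D : ℕ) :
    Module.Finite ℂ ↥(Submodule.span ℂ (setS L κM D D (4 * D)) : Submodule ℂ (Fn L β γ δ)) := by
  haveI : Module.Finite ℂ ↥(Submodule.span ℂ (Set.range (monFamily (β := β) L κM D))) :=
    Module.Finite.span_of_finite ℂ (Set.finite_range _)
  exact Module.Finite.of_injective
    (Submodule.inclusion ((span_setS_le_span_setSred L κM D D (4 * D)).trans
      (Submodule.span_mono (setSred_subset_range L κM D))))
    (Submodule.inclusion_injective _)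

omit [DecidableEq γ] in
/-- `bigV D` is finite-dimensional. [folklore] -/
instance finite_bigV (D : ℕ) : Module.Finite ℂ ↥(bigV (β := β) L κM D) := by
  haveI := finite_span_setS (β := β) L κM D
  exact Module.Finite.map _ _

omit [DecidableEq γ] in
/-- `dim bigV D ≤ (D+1)^{|β|} (D+1)^{|δ|} (2(2D+1))^{|γ|}`. [folklore] -/
theorem finrank_bigV_le (D : ℕ) :
    finrank ℂ ↥(bigV (β := β) L κM D) ≤
      (D + 1) ^ Fintype.card β * ((D + 1) ^ Fintype.card δ * ((2 * D + 1) * 2) ^ Fintype.card γ) := by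
  haveI := finite_span_setS (β := β) L κM D
  exact (Submodule.finrank_map_le _ _).trans (finrank_span_setS_le L κM D)

/-- The restriction `thetaSpace D → bigV D`. [folklore] -/
def resV (D : ℕ) : ↥(thetaSpace (β := β) L κM D) →ₗ[ℂ] ↥(bigV (β := β) L κM D) :=
  LinearMap.codRestrict (bigV L κM D) ((res L).domRestrict (thetaSpace L κM D)) fun f => by
    obtain ⟨P, hP, hPf⟩ := Submodule.mem_map.mp f.2
    have : res L (f : (β ⊕ (γ ⊕ δ) → ℂ) → ℂ) = res L (thetaEval L κM P) := by rw [← hPf]; rfl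
    rw [LinearMap.domRestrict_apply, this]
    exact res_mem_of_isHomogeneous L κM hP

/-- `resV` is the restriction. [folklore] -/
@[simp] theorem coe_resV_apply (D : ℕ) (f : ↥(thetaSpace (β := β) L κM D)) :
    ((resV L κM D f : ↥(bigV (β := β) L κM D)) : Fn L β γ δ) = res L (f : (β ⊕ (γ ⊕ δ) → ℂ) → ℂ) :=
  rfl

/-- **The restriction is injective on theta polynomials** (density of `offDiv`). [folklore] -/
theorem resV_injective (D : ℕ) : Function.Injective (resV (β := β) L κM D) := by
  intro f₁ f₂ h
  have h' : res L (f₁ : (β ⊕ (γ ⊕ δ) → ℂ) → ℂ) = res L f₂ := by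
    have := congr_arg (fun v : ↥(bigV (β := β) L κM D) => (v : Fn L β γ δ)) h
    simpa using this
  have hsub : res L ((f₁ : (β ⊕ (γ ⊕ δ) → ℂ) → ℂ) - (f₂ : (β ⊕ (γ ⊕ δ) → ℂ) → ℂ)) = 0 := by
    rw [map_sub, h', sub_self]
  have := eq_zero_of_res_eq_zero L κM (Submodule.sub_mem _ f₁.2 f₂.2) hsub
  exact Subtype.ext (sub_eq_zero.mp this)

/-- The space of theta polynomials of degree `D` is finite-dimensional. [folklore] -/
instance finite_thetaSpace (D : ℕ) : Module.Finite ℂ ↥(thetaSpace (β := β) L κM D) :=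
  Module.Finite.of_injective (resV L κM D) (resV_injective L κM D)

/-- **`H(M_κ; D) ≤ 6ⁿ Dⁿ`**: the space of theta polynomials of degree `D ≥ 1` on `Lie M_κ,ℂ`
has dimension at most `6ⁿ·Dⁿ`, `n = |β| + |γ| + |δ| = dim M_κ` — the elementary upper bound for
the Hilbert function of the theta-embedded group `M_κ` (`ℋ(G; D) = deg(G)·Dⁿ`).
[cite: NesterenkoPhilippon2001, Ch. 11 §2.2 ((85), ℋ(I; D) = c D^d)] -/
theorem finrank_thetaSpace_le {D : ℕ} (hD : 1 ≤ D) :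
    finrank ℂ ↥(thetaSpace (β := β) L κM D) ≤
      6 ^ Fintype.card (β ⊕ (γ ⊕ δ)) * D ^ Fintype.card (β ⊕ (γ ⊕ δ)) := by
  have h1 : D + 1 ≤ 6 * D := by omega
  have h2 : (2 * D + 1) * 2 ≤ 6 * D := by omega
  calc finrank ℂ ↥(thetaSpace (β := β) L κM D)
      ≤ finrank ℂ ↥(bigV (β := β) L κM D) := LinearMap.finrank_le_finrank_of_injective (resV_injective L κM D)
    _ ≤ (D + 1) ^ Fintype.card β * ((D + 1) ^ Fintype.card δ * ((2 * D + 1) * 2) ^ Fintype.card γ) :=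
        finrank_bigV_le L κM D
    _ ≤ (6 * D) ^ Fintype.card β * ((6 * D) ^ Fintype.card δ * (6 * D) ^ Fintype.card γ) :=
        Nat.mul_le_mul (Nat.pow_le_pow_left h1 _)
          (Nat.mul_le_mul (Nat.pow_le_pow_left h1 _) (Nat.pow_le_pow_left h2 _))
    _ = 6 ^ Fintype.card (β ⊕ (γ ⊕ δ)) * D ^ Fintype.card (β ⊕ (γ ⊕ δ)) := by
        simp only [Fintype.card_sum, mul_pow, pow_add]
        ring

/-- **Corollary (Hilbert function form).** Linearly independent theta polynomials of degree
`D ≥ 1` (forms `P_i` of degree `D` with `ℂ`-linearly independent `F_{P_i}`) number at most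
`6ⁿ Dⁿ`. [cite: NesterenkoPhilippon2001, Ch. 11 §2.2] -/
theorem card_le_of_linearIndependent_thetaEval {ι : Type} [Fintype ι] {D : ℕ} (hD : 1 ≤ D)
    (P : ι → MvPolynomial (Option β × ThetaIdx γ δ) ℂ) (hP : ∀ i, (P i).IsHomogeneous D)
    (hli : LinearIndependent ℂ fun i => thetaEval L κM (P i)) :
    Fintype.card ι ≤ 6 ^ Fintype.card (β ⊕ (γ ⊕ δ)) * D ^ Fintype.card (β ⊕ (γ ⊕ δ)) := by
  have hmem : ∀ i, thetaEval L κM (P i) ∈ thetaSpace (β := β) L κM D := fun i =>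
    Submodule.mem_map.mpr ⟨P i, (mem_homogeneousSubmodule D (P i)).mpr (hP i), rfl⟩
  have hli' : LinearIndependent ℂ fun i => (⟨thetaEval L κM (P i), hmem i⟩ : ↥(thetaSpace (β := β) L κM D)) := by
    apply LinearIndependent.of_comp (thetaSpace (β := β) L κM D).subtype
    exact hli
  calc Fintype.card ι ≤ finrank ℂ ↥(thetaSpace (β := β) L κM D) := hli'.fintype_card_le_finrank
    _ ≤ _ := finrank_thetaSpace_le L κM hD

end Std

end GaGmE

end Literature.NumberTheory.Transcendental

end
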